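import Mathlib.Analysis.SpecialFunctions.Pow.Real
import HarnessLib

/-!
# QUANT lane R8, T-DEC: the algebra of TOP-AFFORDABLE two-point components (Theorem A of DEC-TAMP-G50)

builds on p205010 (kernel theorem, internal audit signed; external expert review pending)

Support file (`--supports stmt-CriticalPhenomena-4575`), QUANT lane seat prim-quant-census-2 (gen 50); memo
`run/shared/lean/prim/quant/prim-quant-census-2-g50/DEC-TAMP-G50.md` §1.  Pure real algebra (no probability), for the typer's
root reduction (`…QuantRootReduction.lean`, `RootDec.rtail_ge_of_heavyDec` / `rtail_ge_of_decCert`).  Theorems only; no sorries;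
standard axioms.

SETTING.  A two-point component `{lo, hi; g}` is the law "`hi` with probability `g`, `lo` with probability `1 − g`" (`lo ≤ hi`);
its mean is `lo + (hi − lo)·g`; at floor `y` its ARCH credit (architecture of record, README V185) is `2·lo + (hi − lo)·κ_y(g)` with
`κ_y(g) = g` for `g ≥ y` and `κ_y(g) = (g − y²)/(1 − y)` for `g < y` (discounted LIGHT blob).  THEOREM A of the memo: every
tree-structure law is an exact mixture of two-point components with (i) mean `= T` (the structure's mean) and (ii) TOP-AFFORDABILITY
`y·hi ≤ T`.  This file proves the three pieces of algebra behind it: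

* `TAMP.mean_le_credit_of_light` / `mean_le_credit_of_heavy` — (r3) of the memo: a component with mean `T` and `y·hi ≤ T` has credit
  `≥ T`; so SURE CREDIT 2 and the LIGHT DISCOUNT are consequences of (i)+(ii), not bookkeeping axioms.
* `TAMP.top_le_of_gate` — Lemma G's top inequality: gating a `(x/h)`-top-affordable inner component by a gate `h ≥ x` carrying `c`
  relays gives an `x`-top-affordable hair law: `x·(c + hi) ≤ h·(c + μ′)`.
* `TAMP.hairAB_*`, `TAMP.hairBC_*` — the two exact MEAN-PRESERVING splits of the gated hair law `{0 : 1−h, k : h(1−g), M : hg}`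
  (mean `T = h((1−g)k + gM)`): (A+B) for `k ≥ T` into `{0,k; T/k}`, `{0,M; T/M}` with weights `h(1−g)k/T`, `hgM/T`; (B+C) for `k < T`
  into `{0,M; T/M}`, `{k,M; (T−k)/(M−k)}` with weights `(1−h)M/(M−T)`, `(hM−T)/(M−T)` — weights in `[0,1]` summing to `1` and the three
  atom masses reproduced exactly (census-2 g49's hair identities ARCH-TREES-G49 §1.1, here for an arbitrary inner component).

[this work]; architecture: prim-quant-census-2 g49/g50 (this lane); the rows served [cite: KozmaNitzan2024, Conjecture 3 (p. 15)].
-/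

namespace Summit.CriticalPhenomena.PercolationContinuityZ3.Theorems

namespace Quant

namespace TAMP

/-! ### (r3): top-affordability forces credit ≥ mean -/

/-- LIGHT case of (r3): if `lo ≤ hi`, `y < 1`, `g ≤ y`, the component `{lo,hi;g}` has mean `T = lo + (hi−lo)g` and is
top-affordable (`y·hi ≤ T`), then its discounted credit `2lo + (hi−lo)(g − y²)/(1−y)` is at least `T` (no sign condition on `lo`
or `y` is needed).  [this work] -/
theorem mean_le_credit_of_light (lo hi g y : ℝ) (hlh : lo ≤ hi) (hy1 : y < 1)
    (hgy : g ≤ y) (htop : y * hi ≤ lo + (hi - lo) * g) :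
    lo + (hi - lo) * g ≤ 2 * lo + (hi - lo) * ((g - y ^ 2) / (1 - y)) := by
  have h1y : 0 < 1 - y := by linarith
  -- key: (hi - lo)(y - g) ≤ lo(1 - y), from top-affordability
  have hkey : (hi - lo) * (y - g) ≤ lo * (1 - y) := by nlinarith
  have hnn : 0 ≤ (hi - lo) * (y - g) := mul_nonneg (by linarith) (by linarith)
  -- hence (hi - lo) y (y - g) ≤ lo (1 - y)
  have hkey2 : (hi - lo) * (y * (y - g)) ≤ lo * (1 - y) := by nlinarith
  rw [show (g - y ^ 2) / (1 - y) = g - y * (y - g) / (1 - y) by field_simp; ring]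
  have : (hi - lo) * (y * (y - g) / (1 - y)) ≤ lo := by
    rw [← mul_div_assoc, div_le_iff₀ h1y]; exact hkey2
  nlinarith

/-- HEAVY case of (r3): with `0 ≤ lo ≤ hi` and any gate, `lo + (hi−lo)g ≤ 2lo + (hi−lo)g`. [this work] -/
theorem mean_le_credit_of_heavy (lo hi g : ℝ) (hlo : 0 ≤ lo) :
    lo + (hi - lo) * g ≤ 2 * lo + (hi - lo) * g := by
  linarith

/-- Unified (r3) with the ARCH credit `2lo + (hi−lo)·κ_y(g)`, `κ_y(g) = if y ≤ g then g else (g − y²)/(1−y)`. [this work] -/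
theorem mean_le_credit (lo hi g y : ℝ) (hlo : 0 ≤ lo) (hlh : lo ≤ hi) (hy1 : y < 1)
    (htop : y * hi ≤ lo + (hi - lo) * g) :
    lo + (hi - lo) * g ≤ 2 * lo + (hi - lo) * (if y ≤ g then g else (g - y ^ 2) / (1 - y)) := by
  split_ifs with h
  · exact mean_le_credit_of_heavy lo hi g hlo
  · exact mean_le_credit_of_light lo hi g y hlh hy1 (le_of_lt (not_le.mp h)) htop

/-- For a HEAVY mean-`T` component top-affordability is automatic: `y ≤ g`, `0 ≤ lo`, `0 ≤ hi` give `y·hi ≤ lo + (hi−lo)g`. [this work] -/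
theorem top_le_of_heavy (lo hi g y : ℝ) (hlo : 0 ≤ lo) (hhi : 0 ≤ hi) (hg1 : g ≤ 1) (hyg : y ≤ g) :
    y * hi ≤ lo + (hi - lo) * g := by
  nlinarith

/-! ### Lemma G: gating preserves top-affordability -/

/-- Lemma G's top inequality: inner component with `(x/h)·hi ≤ μ′` (written `x·hi ≤ h·μ′`), gate `h` with `x ≤ h` when the hub carries
relays (`c > 0`; here `x·c ≤ h·c` is assumed directly, true if `c = 0` or `x ≤ h`): the gated top `c + hi` is affordable at floor `x`
for the target `T = h(c + μ′)`. [this work] -/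
theorem top_le_of_gate (x h c hi μ' : ℝ) (hin : x * hi ≤ h * μ') (hc : x * c ≤ h * c) :
    x * (c + hi) ≤ h * (c + μ') := by
  nlinarith

/-- The tree form of the side condition: if `c = 0` or `x ≤ h` (and `0 ≤ c`) then `x·c ≤ h·c`. [this work] -/
theorem side_of_gate (x h c : ℝ) (hc0 : 0 ≤ c) (h' : c = 0 ∨ x ≤ h) : x * c ≤ h * c := by
  rcases h' with h0 | hxh
  · simp [h0]
  · exact mul_le_mul_of_nonneg_right hxh hc0

/-! ### Lemma G: the two mean-preserving splits of the gated hair law `{0 : 1−h, k : h(1−g), M : hg}`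
The mean is `T = h((1−g)k + gM)`.  In a tree `k = c + lo`, `M = c + hi` for an inner component `{lo,hi;g}` of mean `μ′`, and
`T = h(c + μ′)`. -/

/-- (A+B), case `k ≥ T > 0`: weights `λ_A = h(1−g)k/T`, `λ_B = hgM/T` sum to `1`. [this work] -/
theorem hairAB_weights (h g k M T : ℝ) (hT : T = h * ((1 - g) * k + g * M)) (hT0 : T ≠ 0) :
    h * (1 - g) * k / T + h * g * M / T = 1 := by
  rw [← add_div, div_eq_one_iff_eq hT0, hT]; ring

/-- (A+B): component A `= {0,k; T/k}` with weight `λ_A` puts mass `h(1−g)` at `k` (`k ≠ 0`). [this work] -/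
theorem hairAB_mass_k (h g k T : ℝ) (hk : k ≠ 0) (hT0 : T ≠ 0) :
    (h * (1 - g) * k / T) * (T / k) = h * (1 - g) := by
  field_simp

/-- (A+B): component B `= {0,M; T/M}` with weight `λ_B` puts mass `hg` at `M` (`M ≠ 0`). [this work] -/
theorem hairAB_mass_M (h g M T : ℝ) (hM : M ≠ 0) (hT0 : T ≠ 0) :
    (h * g * M / T) * (T / M) = h * g := by
  field_simp

/-- (A+B): the remaining mass sits at `0` and equals `1 − h`. [this work] -/
theorem hairAB_mass_zero (h g k M T : ℝ) (hT : T = h * ((1 - g) * k + g * M)) (hk : k ≠ 0) (hM : M ≠ 0) (hT0 : T ≠ 0) :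
    (h * (1 - g) * k / T) * (1 - T / k) + (h * g * M / T) * (1 - T / M) = 1 - h := by
  have e1 := hairAB_mass_k h g k T hk hT0
  have e2 := hairAB_mass_M h g M T hM hT0
  have e3 := hairAB_weights h g k M T hT hT0
  calc (h * (1 - g) * k / T) * (1 - T / k) + (h * g * M / T) * (1 - T / M)
      = (h * (1 - g) * k / T + h * g * M / T) - ((h * (1 - g) * k / T) * (T / k) + (h * g * M / T) * (T / M)) := by ring
    _ = 1 - h := by rw [e1, e2, e3]; ring

/-- (A+B): both gates lie in `[0,1]` when `0 < T ≤ k ≤ M`: `0 ≤ T/M ≤ T/k ≤ 1`. [this work] -/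
theorem hairAB_gates (k M T : ℝ) (hT : 0 < T) (hkT : T ≤ k) (hkM : k ≤ M) :
    0 ≤ T / M ∧ T / M ≤ T / k ∧ T / k ≤ 1 := by
  have hk : 0 < k := lt_of_lt_of_le hT hkT
  have hM : 0 < M := lt_of_lt_of_le hk hkM
  refine ⟨div_nonneg hT.le hM.le, ?_, ?_⟩
  · exact div_le_div_of_nonneg_left hT.le hk hkM
  · rw [div_le_one hk]; exact hkT

/-- (A+B): the weights are nonnegative for `h, g ∈ [0,1]`, `0 ≤ k`, `0 ≤ M`, `0 < T`. [this work] -/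
theorem hairAB_weights_nonneg (h g k M T : ℝ) (hh : 0 ≤ h) (hg0 : 0 ≤ g) (hg1 : g ≤ 1) (hk : 0 ≤ k) (hM : 0 ≤ M) (hT : 0 < T) :
    0 ≤ h * (1 - g) * k / T ∧ 0 ≤ h * g * M / T := by
  constructor <;> positivity

/-- (B+C), case `k < T < M`: weights `π_B = (1−h)M/(M−T)`, `π_C = (hM−T)/(M−T)` sum to `1`. [this work] -/
theorem hairBC_weights (h M T : ℝ) (hMT : M - T ≠ 0) :
    (1 - h) * M / (M - T) + (h * M - T) / (M - T) = 1 := by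
  rw [← add_div, div_eq_one_iff_eq hMT]; ring

/-- (B+C): `π_B ∈ [0,1]` when `h ≤ 1`, `0 ≤ M`, `T < M` and `T ≤ hM` (the last holds because the inner mean is at most its top atom).
[this work] -/
theorem hairBC_piB_mem (h M T : ℝ) (hh : h ≤ 1) (hM : 0 ≤ M) (hTM : T < M) (hThM : T ≤ h * M) :
    0 ≤ (1 - h) * M / (M - T) ∧ (1 - h) * M / (M - T) ≤ 1 := by
  have hd : 0 < M - T := by linarith
  refine ⟨div_nonneg (mul_nonneg (by linarith) hM) hd.le, ?_⟩
  rw [div_le_one hd]; nlinarith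

/-- (B+C): `π_C ≥ 0` under `T ≤ hM`, `T < M`. [this work] -/
theorem hairBC_piC_nonneg (h M T : ℝ) (hTM : T < M) (hThM : T ≤ h * M) : 0 ≤ (h * M - T) / (M - T) :=
  div_nonneg (by linarith) (by linarith)

/-- (B+C): the gate of C, `g_C = (T−k)/(M−k)`, lies in `(0,1)` for `k < T < M`, and C has mean `T`: `k + (M−k)·g_C = T`. [this work] -/
theorem hairBC_gateC (k M T : ℝ) (hkT : k < T) (hTM : T < M) :
    0 < (T - k) / (M - k) ∧ (T - k) / (M - k) < 1 ∧ k + (M - k) * ((T - k) / (M - k)) = T := by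
  have hd : 0 < M - k := by linarith
  refine ⟨div_pos (by linarith) hd, ?_, ?_⟩
  · rw [div_lt_one hd]; linarith
  · field_simp; ring

/-- (B+C): mass at `0` is `π_B·(1 − T/M) = 1 − h` (`M ≠ 0`, `M ≠ T`). [this work] -/
theorem hairBC_mass_zero (h M T : ℝ) (hM : M ≠ 0) (hMT : M - T ≠ 0) :
    ((1 - h) * M / (M - T)) * (1 - T / M) = 1 - h := by
  rw [show 1 - T / M = (M - T) / M by field_simp]
  rw [div_mul_div_comm, div_eq_iff (mul_ne_zero hMT hM)]
  ring

/-- (B+C): mass at `M` is `π_B·(T/M) + π_C·g_C = hg`, using the mean relation `T = h((1−g)k + gM)`. [this work] -/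
theorem hairBC_mass_M (h g k M T : ℝ) (hT : T = h * ((1 - g) * k + g * M)) (hM : M ≠ 0) (hMT : M - T ≠ 0) (hMk : M - k ≠ 0) :
    ((1 - h) * M / (M - T)) * (T / M) + ((h * M - T) / (M - T)) * ((T - k) / (M - k)) = h * g := by
  rw [div_mul_div_comm, div_mul_div_comm,
    div_add_div _ _ (mul_ne_zero hMT hM) (mul_ne_zero hMT hMk),
    div_eq_iff (mul_ne_zero (mul_ne_zero hMT hM) (mul_ne_zero hMT hMk))]
  subst hT; ring

/-- (B+C): mass at `k` is `π_C·(1 − g_C) = h(1−g)`, using the mean relation. [this work] -/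
theorem hairBC_mass_k (h g k M T : ℝ) (hT : T = h * ((1 - g) * k + g * M)) (hMT : M - T ≠ 0) (hMk : M - k ≠ 0) :
    ((h * M - T) / (M - T)) * (1 - (T - k) / (M - k)) = h * (1 - g) := by
  rw [show 1 - (T - k) / (M - k) = (M - T) / (M - k) by field_simp; ring]
  rw [div_mul_div_comm, div_eq_iff (mul_ne_zero hMT hMk)]
  subst hT; ring

/-- (B+C) for a tree: with `k = c + lo`, `M = c + hi`, inner mean `μ′ = lo + (hi − lo)g` and `T = h(c + μ′)` the mean relation
`T = h((1−g)k + gM)` holds, and `T ≤ hM` is `μ′ ≤ hi`. [this work] -/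
theorem hair_mean_relation (h g c lo hi : ℝ) :
    h * (c + (lo + (hi - lo) * g)) = h * ((1 - g) * (c + lo) + g * (c + hi)) := by
  ring

/-- The product step (Lemma P of the memo) needs only: tops add and means add.  If `y·hi₁ ≤ T₁` and `y·hi₂ ≤ T₂` then every atom of the
product law, being `≤ hi₁ + hi₂`, is affordable for `T₁ + T₂`. [this work] -/
theorem top_le_of_sum (y hi₁ hi₂ T₁ T₂ a : ℝ) (hy : 0 ≤ y) (h1 : y * hi₁ ≤ T₁) (h2 : y * hi₂ ≤ T₂) (ha : a ≤ hi₁ + hi₂) :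
    y * a ≤ T₁ + T₂ := by
  nlinarith

end TAMP

end Quant

end Summit.CriticalPhenomena.PercolationContinuityZ3.Theorems
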